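import Summits.CriticalPhenomena.PercolationContinuityZ3.Theorems.PercNearOneGluingNoHeavyLowerTailSahiC3CubeThreeFKGPrelim
import Mathlib.Tactic.Linarith
import Mathlib.Tactic.Ring
import HarnessLib
import HarnessLib.Audit

/-!
# `NoHeavyLowerTail` (crux stmt-CriticalPhenomena-4575), Sahi programme P4: data-encoded cubic certificates on the `3`-cube

Support file (cell `prim-l12`, seat P4; `--supports stmt-CriticalPhenomena-4575`).  No named facts, no sorries; standard axioms.

Sahi's `C₃` on `{0,1}⁴` for FKG weights reduces (HOME prim-l12-p4/FINDING-gen4-FKG-CUBE4-C3.md) to eleven `S₄`-orbits of tri-saturated triples; ten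
carry Ahlswede–Daykin certificates and the last one, `(x₁ ∨ x₂x₃, x₂ ∨ x₃x₄, x₄ ∨ x₁x₃)`, is handled by splitting the weight along `x₃` and two
ratio-monotone layer cakes (`…SahiE3DeterminedMeetFKGFibres.sum_mul_nonneg_of_ratioMonotone`), which leave finitely many CUBIC INEQUALITIES FOR ONE
LOG-SUPERMODULAR WEIGHT `ρ` ON THE `3`-CUBE `Fin 3 → Bool`.  Those inequalities (`…SahiC3CubeFourFKGOrbit5Layers*`) are stated and certified through
the three evaluators of this file, so that each certificate is a short list of natural-number data checked by `ring` and `decide`: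
* `evalPoly3 ρ L = Σ_{(c,i,j,k) ∈ L} c · ρ(pᵢ)ρ(pⱼ)ρ(pₖ)` (`c : ℤ`, `pᵢ = ptB 3 i` the cube point with code `i`);
* `evalMon3 ρ L = Σ c · ρ(pᵢ)ρ(pⱼ)ρ(pₖ)` with `c : ℕ` — nonnegative for `ρ ≥ 0` (`evalMon3_nonneg`);
* `evalMin3 ρ L = Σ_{(c,z,x,y,m,j)} c · ρ(p_z) · (ρ(p_m)ρ(p_j) − ρ(p_x)ρ(p_y))` — nonnegative for a nonnegative log-supermodular `ρ` as soon as
  `m = x AND y`, `j = x OR y` bitwise for every entry (`evalMin3_nonneg`; the point FKG minors, via `ptB_land'/ptB_lor'`).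
-/

namespace Summit.CriticalPhenomena.PercolationContinuityZ3.Theorems.SahiC3CubeFourFKG

open Finset Literature.Probability.LatticeModels SahiC3Cube

/-- `ptB` turns bitwise `and` of codes into the meet of cube points. [this work] -/
theorem ptB_land' (m i j : ℕ) : ptB m i ⊓ ptB m j = ptB m (i &&& j) := by
  funext k
  show (i.testBit k && j.testBit k) = (i &&& j).testBit k
  rw [Nat.testBit_land]

/-- `ptB` turns bitwise `or` of codes into the join of cube points. [this work] -/
theorem ptB_lor' (m i j : ℕ) : ptB m i ⊔ ptB m j = ptB m (i ||| j) := by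
  funext k
  show (i.testBit k || j.testBit k) = (i ||| j).testBit k
  rw [Nat.testBit_lor]

/-- Signed cubic form from data: `Σ c · ρ(pᵢ)ρ(pⱼ)ρ(pₖ)`, `c : ℤ`. [this work] -/
def evalPoly3 (ρ : (Fin 3 → Bool) → ℝ) (L : List (ℤ × ℕ × ℕ × ℕ)) : ℝ :=
  (L.map fun e => (e.1 : ℝ) * (ρ (ptB 3 e.2.1) * ρ (ptB 3 e.2.2.1) * ρ (ptB 3 e.2.2.2))).sum

/-- Nonnegative cubic monomials from data: `Σ c · ρ(pᵢ)ρ(pⱼ)ρ(pₖ)`, `c : ℕ`. [this work] -/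
def evalMon3 (ρ : (Fin 3 → Bool) → ℝ) (L : List (ℕ × ℕ × ℕ × ℕ)) : ℝ :=
  (L.map fun e => (e.1 : ℝ) * (ρ (ptB 3 e.2.1) * ρ (ptB 3 e.2.2.1) * ρ (ptB 3 e.2.2.2))).sum

/-- Weighted point minors from data: `Σ c · ρ(p_z) · (ρ(p_m)ρ(p_j) − ρ(p_x)ρ(p_y))` for entries `(c, z, x, y, m, j)`. [this work] -/
def evalMin3 (ρ : (Fin 3 → Bool) → ℝ) (L : List (ℕ × ℕ × ℕ × ℕ × ℕ × ℕ)) : ℝ :=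
  (L.map fun e => (e.1 : ℝ) * ρ (ptB 3 e.2.1) *
    (ρ (ptB 3 e.2.2.2.2.1) * ρ (ptB 3 e.2.2.2.2.2) - ρ (ptB 3 e.2.2.1) * ρ (ptB 3 e.2.2.2.1))).sum

/-- `evalMon3 ρ L ≥ 0` for a nonnegative weight. [this work] -/
theorem evalMon3_nonneg {ρ : (Fin 3 → Bool) → ℝ} (hρ₀ : 0 ≤ ρ) (L : List (ℕ × ℕ × ℕ × ℕ)) : 0 ≤ evalMon3 ρ L := by
  unfold evalMon3
  induction L with
  | nil => simp
  | cons e L ih =>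
    rw [List.map_cons, List.sum_cons]
    exact add_nonneg (mul_nonneg (by positivity) (mul_nonneg (mul_nonneg (hρ₀ _) (hρ₀ _)) (hρ₀ _))) ih

/-- `evalMin3 ρ L ≥ 0` for a nonnegative log-supermodular weight when every entry `(c, z, x, y, m, j)` has `m = x AND y` and `j = x OR y`
(checked by `decide` on the data). [this work] -/
theorem evalMin3_nonneg {ρ : (Fin 3 → Bool) → ℝ} (hρ₀ : 0 ≤ ρ) (hρ : ∀ a b, ρ a * ρ b ≤ ρ (a ⊓ b) * ρ (a ⊔ b))
    (L : List (ℕ × ℕ × ℕ × ℕ × ℕ × ℕ)) (hL : ∀ e ∈ L, e.2.2.2.2.1 = (e.2.2.1 &&& e.2.2.2.1) ∧ e.2.2.2.2.2 = (e.2.2.1 ||| e.2.2.2.1)) :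
    0 ≤ evalMin3 ρ L := by
  unfold evalMin3
  induction L with
  | nil => simp
  | cons e L ih =>
    rw [List.map_cons, List.sum_cons]
    have he := hL e (List.mem_cons_self)
    have hmin : ρ (ptB 3 e.2.2.1) * ρ (ptB 3 e.2.2.2.1) ≤ ρ (ptB 3 e.2.2.2.2.1) * ρ (ptB 3 e.2.2.2.2.2) := by
      rw [he.1, he.2, ← ptB_land', ← ptB_lor']
      exact hρ _ _
    exact add_nonneg (mul_nonneg (mul_nonneg (by positivity) (hρ₀ _)) (sub_nonneg.2 hmin))
      (ih fun e' he' => hL e' (List.mem_cons_of_mem _ he'))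

/-- From `d · x ≥ 0` with `d > 0` (a natural-number scaling of a certificate) to `x ≥ 0`. [folklore] -/
theorem nonneg_of_nat_mul_nonneg {d : ℕ} (hd : 0 < d) {x : ℝ} (h : 0 ≤ (d : ℝ) * x) : 0 ≤ x :=
  nonneg_of_mul_nonneg_right (by rwa [mul_comm] at h) (by exact_mod_cast hd)

end Summit.CriticalPhenomena.PercolationContinuityZ3.Theorems.SahiC3CubeFourFKG
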